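import Summits.Ventures.PercRepro.RankDistWeighted
import Summits.Ventures.PercRepro.PerFlatTransfer

/-!
# PercRepro — the coloop-weighted double count on the shadow of the bottom sets (p9, gen 17)

`RankDistWeighted` counts on the whole rank level; the count is LOCAL (as g16's `CogirthHall.fam_step`) and runs
inside the upper shadow `∂_u 𝓑` (`shadowLev M u 𝓑`: the rank-`u` sets containing a member) of the bottom sets
`𝓑 = PerFlat.Uq M p q` (`ρ(B) = q`, `ρ(E ∖ B) = p`), with the weights `1/κ_𝒮(A ∪ e)` where `κ_𝒮(A')` counts only the
coloops `e'` of `A'` with `A' ∖ e' ∈ 𝒮` (`dropSetIn`):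
* `fam_weighted` — for families `𝒮` (rank `u`) and `𝒯` (rank `u + 1`) with `A ∪ e ∈ 𝒯` for `A ∈ 𝒮`, `e ∉ cl(A)`:
  `Σ_{A ∈ 𝒮} Σ_{e ∉ cl A} 1/κ_𝒮(A ∪ e) ≤ #𝒯` — every `A' ∈ 𝒯` with a coloop-removal into `𝒮` hands `1/κ_𝒮(A')` to
  each such removal;
* `shadowLev_step_of_weighted`, `shadowLev_mul_choose_of_step`, `rls_of_shadowStep`, **`rls_of_shadowWeighted`** —
  C-025 at `(p, q)` as soon as `(p + q − u)·#∂_u 𝓑 ≤ (u + 1)·Σ_{A ∈ ∂_u 𝓑} Σ_{e ∉ cl A} 1/κ_{∂_u 𝓑}(A ∪ e)` for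
  every `q ≤ u ≤ p − 2` (the chain starts at `#𝓑 ≤ #∂_q 𝓑` and ends at `#∂_u 𝓑 ≤ c_u`).
The shadow form is the strongest of the criteria of this lane: the sets of rank `q` that contain no bottom set
(the fat rank-`q` flats of the first layer of a block family) are never counted, and a coloop whose removal leaves
the shadow is not charged. Nothing here is a statement about any window of the crux.
-/

namespace PercRepro.RankDist

open Set Finset Matroid PercRepro.ThmH

variable {α : Type}

open scoped Classical in
/-- The upper shadow of a family `𝒜` of finsets at the rank level `u`: the subsets `A ⊆ E` of rank `u` containing
some `B ∈ 𝒜` (the `Set`-side family of g16's `CogirthHall.shadowFin`, re-declared here so that this file depends on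
`RankDistWeighted` and `PerFlatTransfer` only). -/
noncomputable def shadowLev (M : Matroid α) [M.Finite] (u : ℕ) (𝒜 : Finset (Finset α)) : Finset (Set α) :=
  (subsetsFin M).filter (fun A => rk M A = u ∧ ∃ B ∈ 𝒜, (B : Set α) ⊆ A)

/-- Membership in `shadowLev`. -/
lemma mem_shadowLev (M : Matroid α) [M.Finite] {u : ℕ} {𝒜 : Finset (Finset α)} {A : Set α} :
    A ∈ shadowLev M u 𝒜 ↔ A ⊆ M.E ∧ rk M A = u ∧ ∃ B ∈ 𝒜, (B : Set α) ⊆ A := by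
  unfold shadowLev
  simp only [Finset.mem_filter, mem_subsetsFin]

/-- The shadow at level `u` is a sub-family of the rank-`u` sets. -/
theorem card_shadowLev_le_levelCount (M : Matroid α) [M.Finite] (u : ℕ) (𝒜 : Finset (Finset α)) :
    (shadowLev M u 𝒜).card ≤ levelCount M u := by
  rw [levelCount]
  refine Finset.card_le_card fun A hA => ?_
  rw [mem_shadowLev] at hA
  rw [mem_filter, mem_subsetsFin]
  exact ⟨hA.1, hA.2.1⟩

open scoped Classical in
/-- The coloops of `A` (at rank `u + 1`) whose removal lands in the family `𝒮`. -/
noncomputable def dropSetIn (M : Matroid α) [M.Finite] (𝒮 : Finset (Set α)) (A : Set α) (u : ℕ) : Finset α :=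
  (dropSet M A u).filter (fun e => A \ {e} ∈ 𝒮)

/-- Membership in `dropSetIn`. -/
lemma mem_dropSetIn (M : Matroid α) [M.Finite] {𝒮 : Finset (Set α)} {A : Set α} {u : ℕ} {e : α} :
    e ∈ dropSetIn M 𝒮 A u ↔ e ∈ dropSet M A u ∧ A \ {e} ∈ 𝒮 := by
  unfold dropSetIn
  simp only [Finset.mem_filter]

/-- **THE WEIGHTED DOUBLE COUNT FOR A PAIR OF FAMILIES**: `𝒮` a family of rank-`u` subsets of `E`, `𝒯` a family of
rank-`(u + 1)` subsets containing `A ∪ e` for every `A ∈ 𝒮` and every rank-increasing `e`; then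
`Σ_{A ∈ 𝒮} Σ_{e ∈ extSet A} 1/#dropSetIn 𝒮 (A ∪ e) u ≤ #𝒯`. -/
theorem fam_weighted (M : Matroid α) [M.Finite] (u : ℕ) (𝒮 𝒯 : Finset (Set α))
    (h𝒮 : ∀ A ∈ 𝒮, A ⊆ M.E ∧ rk M A = u)
    (hclosed : ∀ A ∈ 𝒮, ∀ e ∈ extSet M A, insert e A ∈ 𝒯) :
    ∑ A ∈ 𝒮, ∑ e ∈ extSet M A, (1 : ℚ) / ((dropSetIn M 𝒮 (insert e A) u).card : ℚ) ≤ (𝒯.card : ℚ) := by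
  classical
  set s : Finset (Σ _ : Set α, α) := 𝒮.sigma (fun A => extSet M A) with hs
  set t : Finset (Σ _ : Set α, α) := 𝒯.sigma (fun A => dropSetIn M 𝒮 A u) with ht
  set g : (Σ _ : Set α, α) → (Σ _ : Set α, α) := fun x => ⟨insert x.2 x.1, x.2⟩ with hg
  have h1 : ∑ A ∈ 𝒮, ∑ e ∈ extSet M A, (1 : ℚ) / ((dropSetIn M 𝒮 (insert e A) u).card : ℚ)
      = ∑ x ∈ s, (1 : ℚ) / ((dropSetIn M 𝒮 (insert x.2 x.1) u).card : ℚ) := by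
    rw [hs, Finset.sum_sigma]
  have hmem : ∀ x ∈ s, g x ∈ t := by
    intro x hx
    rw [hs, Finset.mem_sigma] at hx
    obtain ⟨hxS, hxe⟩ := hx
    obtain ⟨hxE, hxu⟩ := h𝒮 x.1 hxS
    have hnot : x.2 ∉ x.1 := notMem_of_mem_extSet M hxE hxe
    have hT := hclosed x.1 hxS x.2 hxe
    rw [mem_extSet] at hxe
    rw [ht, Finset.mem_sigma, mem_dropSetIn, mem_dropSet]
    refine ⟨hT, ⟨hxe.1, Set.mem_insert _ _, ?_⟩, ?_⟩
    · rw [Set.insert_sdiff_self_of_notMem hnot]; exact hxu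
    · rw [Set.insert_sdiff_self_of_notMem hnot]; exact hxS
  have hinj : Set.InjOn g s := by
    intro x hx y hy hxy
    rw [Finset.mem_coe, hs, Finset.mem_sigma] at hx hy
    have hnx : x.2 ∉ x.1 := notMem_of_mem_extSet M (h𝒮 x.1 hx.1).1 hx.2
    have hny : y.2 ∉ y.1 := notMem_of_mem_extSet M (h𝒮 y.1 hy.1).1 hy.2
    simp only [hg, Sigma.mk.inj_iff, heq_iff_eq] at hxy
    obtain ⟨hAB, hee⟩ := hxy
    rw [← hee] at hAB
    have hAB' : x.1 = y.1 := by
      rw [← Set.insert_sdiff_self_of_notMem hnx, hAB, Set.insert_sdiff_self_of_notMem (hee ▸ hny)]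
    exact Sigma.ext hAB' (heq_of_eq hee)
  have h2 : ∑ x ∈ s, (1 : ℚ) / ((dropSetIn M 𝒮 (insert x.2 x.1) u).card : ℚ)
      ≤ ∑ y ∈ t, (1 : ℚ) / ((dropSetIn M 𝒮 y.1 u).card : ℚ) := by
    have hsum := Finset.sum_image
      (f := fun y : (Σ _ : Set α, α) => (1 : ℚ) / ((dropSetIn M 𝒮 y.1 u).card : ℚ)) (s := s) (g := g) hinj
    simp only [hg] at hsum
    rw [← hsum]
    refine Finset.sum_le_sum_of_subset_of_nonneg ?_ ?_
    · intro y hy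
      rw [Finset.mem_image] at hy
      obtain ⟨x, hx, rfl⟩ := hy
      exact hmem x hx
    · intro y _ _
      positivity
  have h3 : ∑ y ∈ t, (1 : ℚ) / ((dropSetIn M 𝒮 y.1 u).card : ℚ) ≤ (𝒯.card : ℚ) := by
    rw [ht, Finset.sum_sigma, Finset.card_eq_sum_ones, Nat.cast_sum]
    refine Finset.sum_le_sum fun A _ => ?_
    show ∑ _ ∈ dropSetIn M 𝒮 A u, (1 : ℚ) / ((dropSetIn M 𝒮 A u).card : ℚ) ≤ ((1 : ℕ) : ℚ)
    rw [Finset.sum_const, nsmul_eq_mul, Nat.cast_one]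
    by_cases h : (dropSetIn M 𝒮 A u).card = 0
    · rw [h]; simp
    · rw [mul_one_div_cancel (by exact_mod_cast h)]
  rw [h1]
  exact h2.trans h3

/-- The shadow weight of a set `A` at level `u` over the family `𝒜`: `Σ_{e ∉ cl A} 1/κ_{∂_u 𝒜}(A ∪ e)`. -/
noncomputable def shadowWeight (M : Matroid α) [M.Finite] (𝒜 : Finset (Finset α)) (u : ℕ) (A : Set α) : ℚ :=
  ∑ e ∈ extSet M A, (1 : ℚ) / ((dropSetIn M (shadowLev M u 𝒜) (insert e A) u).card : ℚ)

/-- The weighted double count on the shadow: `Σ_{A ∈ ∂_u 𝒜} shadowWeight A ≤ #∂_{u+1} 𝒜`. -/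
theorem sum_shadowWeight_le (M : Matroid α) [M.Finite] (𝒜 : Finset (Finset α)) (u : ℕ) :
    ∑ A ∈ shadowLev M u 𝒜, shadowWeight M 𝒜 u A ≤ ((shadowLev M (u + 1) 𝒜).card : ℚ) := by
  refine fam_weighted M u _ _ ?_ ?_
  · intro A hA
    rw [mem_shadowLev] at hA
    exact ⟨hA.1, hA.2.1⟩
  · intro A hA e he
    rw [mem_shadowLev] at hA ⊢
    obtain ⟨hAE, hAu, B, hB, hBA⟩ := hA
    have heE : e ∈ M.E := (mem_extSet M |>.1 he).1
    refine ⟨Set.insert_subset heE hAE, ?_, B, hB, hBA.trans (Set.subset_insert _ _)⟩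
    rw [rk_eq_iff M (Set.insert_subset heE hAE), (mem_extSet M |>.1 he).2, eRk_eq_coe_rk M hAE, hAu]
    push_cast; rfl

/-- The shadow step from the weighted hypothesis at level `u`. -/
theorem shadowLev_step_of_weighted (M : Matroid α) [M.Finite] (p q u : ℕ) (𝒜 : Finset (Finset α))
    (hW : ((p + q - u : ℕ) : ℚ) * (shadowLev M u 𝒜).card
      ≤ (u + 1 : ℚ) * ∑ A ∈ shadowLev M u 𝒜, shadowWeight M 𝒜 u A) :
    (p + q - u) * (shadowLev M u 𝒜).card ≤ (u + 1) * (shadowLev M (u + 1) 𝒜).card := by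
  have h := sum_shadowWeight_le M 𝒜 u
  have h' : ((p + q - u : ℕ) : ℚ) * (shadowLev M u 𝒜).card
      ≤ (u + 1 : ℚ) * (shadowLev M (u + 1) 𝒜).card :=
    hW.trans (mul_le_mul_of_nonneg_left h (by positivity))
  exact_mod_cast h'

/-- Pascal's ratio along the shadow from the one-step inequalities at the levels `q … p − 2` alone:
`#∂_q 𝒜·C(p+q, u) ≤ #∂_u 𝒜·C(p+q, q)` for `q ≤ u ≤ p − 1`. -/
theorem shadowLev_mul_choose_of_step (M : Matroid α) [M.Finite] (p q : ℕ) (𝒜 : Finset (Finset α))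
    (hstep : ∀ u, q ≤ u → u + 2 ≤ p →
      (p + q - u) * (shadowLev M u 𝒜).card ≤ (u + 1) * (shadowLev M (u + 1) 𝒜).card) :
    ∀ u, q ≤ u → u + 1 ≤ p →
      (shadowLev M q 𝒜).card * (p + q).choose u ≤ (shadowLev M u 𝒜).card * (p + q).choose q := by
  intro u hqu
  induction u, hqu using Nat.le_induction with
  | base => intro _; exact le_refl _
  | succ u hqu ih =>
    intro hup
    have ih' := ih (by omega)
    have hs := hstep u hqu (by omega)
    have hpas := Nat.choose_succ_right_eq (p + q) u
    have key : (shadowLev M q 𝒜).card * (p + q).choose (u + 1) * (u + 1)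
        ≤ (shadowLev M (u + 1) 𝒜).card * (p + q).choose q * (u + 1) := by
      calc (shadowLev M q 𝒜).card * (p + q).choose (u + 1) * (u + 1)
          = (shadowLev M q 𝒜).card * ((p + q).choose u * (p + q - u)) := by rw [mul_assoc, hpas]
        _ = ((shadowLev M q 𝒜).card * (p + q).choose u) * (p + q - u) := by ring
        _ ≤ ((shadowLev M u 𝒜).card * (p + q).choose q) * (p + q - u) := Nat.mul_le_mul_right _ ih'
        _ = ((p + q - u) * (shadowLev M u 𝒜).card) * (p + q).choose q := by ring
        _ ≤ ((u + 1) * (shadowLev M (u + 1) 𝒜).card) * (p + q).choose q := Nat.mul_le_mul_right _ hs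
        _ = (shadowLev M (u + 1) 𝒜).card * (p + q).choose q * (u + 1) := by ring
    exact Nat.le_of_mul_le_mul_right key (by omega)

variable [DecidableEq α] (M : Matroid α) [M.Finite]

/-- The bottom sets inject into their own shadow at level `q`. -/
theorem card_Uq_le_card_shadowLev (p q : ℕ) :
    (PerFlat.Uq M p q).card ≤ (shadowLev M q (PerFlat.Uq M p q)).card := by
  refine Finset.card_le_card_of_injOn (fun B => (B : Set α)) ?_ ?_
  · intro B hB
    rw [Finset.mem_coe] at hB
    have hBq := hB
    rw [PerFlat.mem_Uq] at hBq
    have hBE : (B : Set α) ⊆ M.E := by rw [← coe_gr M]; exact Finset.coe_subset.2 hBq.1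
    rw [Finset.mem_coe, mem_shadowLev]
    exact ⟨hBE, (rk_eq_iff M hBE q).2 hBq.2.1, B, hB, subset_refl _⟩
  · intro B _ C _ hBC
    exact Finset.coe_injective hBC

/-- **C-025 FROM THE SHADOW STEPS AT THE LEVELS `q … p − 2`**: if `(p + q − u)·#∂_u 𝓑 ≤ (u + 1)·#∂_{u+1} 𝓑` over
the bottom sets `𝓑 = PerFlat.Uq M p q` for every `q ≤ u ≤ p − 2`, then `ThmN.RLS M p q`. -/
theorem rls_of_shadowStep (p q : ℕ)
    (hstep : ∀ u, q ≤ u → u + 2 ≤ p → (p + q - u) * (shadowLev M u (PerFlat.Uq M p q)).card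
      ≤ (u + 1) * (shadowLev M (u + 1) (PerFlat.Uq M p q)).card) : ThmN.RLS M p q := by
  unfold ThmN.RLS phiK
  have hU := PerFlat.ncard_U_le_card_Uq M p q
  rw [ncard_Y_eq_sum M p q]
  have hpos : (0 : ℚ) < ((p + q).choose p : ℚ) := by
    exact_mod_cast Nat.choose_pos (by omega)
  rw [div_mul_eq_mul_div, div_le_iff₀ hpos]
  have key : (∑ u ∈ Ioo q p, (p + q).choose u)
      * {A : Set α | A ⊆ M.E ∧ M.eRk A = (p : ℕ∞) ∧ M.eRk (M.E \ A) = (q : ℕ∞)}.ncard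
      ≤ (∑ u ∈ Ioo q p, levelCount M u) * (p + q).choose p := by
    calc (∑ u ∈ Ioo q p, (p + q).choose u)
          * {A : Set α | A ⊆ M.E ∧ M.eRk A = (p : ℕ∞) ∧ M.eRk (M.E \ A) = (q : ℕ∞)}.ncard
        ≤ (∑ u ∈ Ioo q p, (p + q).choose u) * (PerFlat.Uq M p q).card := Nat.mul_le_mul_left _ hU
      _ = ∑ u ∈ Ioo q p, (PerFlat.Uq M p q).card * (p + q).choose u := by
          rw [Finset.sum_mul]; exact Finset.sum_congr rfl fun u _ => mul_comm _ _
      _ ≤ ∑ u ∈ Ioo q p, (shadowLev M u (PerFlat.Uq M p q)).card * (p + q).choose q := by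
          refine Finset.sum_le_sum fun u hu => ?_
          rw [Finset.mem_Ioo] at hu
          have h1 := card_Uq_le_card_shadowLev M p q
          have h2 := shadowLev_mul_choose_of_step M p q (PerFlat.Uq M p q) hstep u (by omega) (by omega)
          exact (Nat.mul_le_mul_right _ h1).trans h2
      _ ≤ ∑ u ∈ Ioo q p, levelCount M u * (p + q).choose q := by
          refine Finset.sum_le_sum fun u _ => ?_
          exact Nat.mul_le_mul_right _ (card_shadowLev_le_levelCount M u _)
      _ = (∑ u ∈ Ioo q p, levelCount M u) * (p + q).choose p := by
          rw [Finset.sum_mul, Nat.choose_symm_add]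
  exact_mod_cast key

/-- **C-025 UNDER THE SHADOW-WEIGHTED CRITERION**: if for every `q ≤ u ≤ p − 2`
`(p + q − u)·#∂_u 𝓑 ≤ (u + 1)·Σ_{A ∈ ∂_u 𝓑} Σ_{e ∉ cl A} 1/κ_{∂_u 𝓑}(A ∪ e)` over the bottom sets
`𝓑 = PerFlat.Uq M p q`, then `ThmN.RLS M p q`. -/
theorem rls_of_shadowWeighted (p q : ℕ)
    (hW : ∀ u, q ≤ u → u + 2 ≤ p →
      ((p + q - u : ℕ) : ℚ) * (shadowLev M u (PerFlat.Uq M p q)).card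
        ≤ (u + 1 : ℚ) * ∑ A ∈ shadowLev M u (PerFlat.Uq M p q), shadowWeight M (PerFlat.Uq M p q) u A) :
    ThmN.RLS M p q :=
  rls_of_shadowStep M p q fun u hqu hup => shadowLev_step_of_weighted M p q u _ (hW u hqu hup)

end PercRepro.RankDist
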